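/-
Literature/NumberTheory/ComplexMultiplication/DegenerateCMTypesAbelianKernelsIndexFourTwoOddPrimes.lean — pub-hodgecm2 (COR-CM), KEPT
Literature lane lit-deligne-3 gen 65, file F65b.  THEOREMS ONLY (no `def`, no named fact, no `sorry`, no instance, no notation;
D-0026 net debt 0).  HC_CM is NOT proved.
-/
import Literature.NumberTheory.ComplexMultiplication.DegenerateCMTypesAbelianKernelsIndexTwoOddPrimes
import Literature.NumberTheory.NumberFields.CyclotomicGaussianIndependence
import HarnessLib

/-!
# Kernels of index `4pq` in a finite abelian group (`p ≠ q` odd primes): the characters vanish on a CM type iff its coset counts are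
# ADDITIVELY SEPARABLE along the odd part of the quotient — Gaussian coordinates over the `pq`-th roots of unity

Topic `Literature/NumberTheory/ComplexMultiplication` (namespace `Literature.NumberTheory.ComplexMultiplication.CyclicCMType{,.AbelianKernels}`);
cell `pub-hodgecm2` (COR-CM), KEPT Literature lane `lit-deligne-3` gen 65, file F65b — the second step of the lane's TWO-ODD-PRIMES programme for
non-cyclic groups: the kernel decision at index `4pq`, for ANY finite abelian group, in the format of the tree's kernel decisions (`…iff_of_index_two`,
`…of_index_four`, `…equidistributed_of_index` (`2p^{j+1}`), lane `…of_index_four_mul{,_primePow}` (`4p^{j+1}`), F64i `…separable_of_index_two_mul_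
odd_primes` (`2pq`)).  With it every admissible kernel of an abelian group of EXPONENT `4pq` (`ℤ/60 ≅ (ℤ/61)ˣ`, `(ℤ/122)ˣ`; `ℤ/2 × ℤ/60 ≅ (ℤ/183)ˣ`,
`(ℤ/244)ˣ`, …) is decided; the rank formula is the sequel.  KERNEL ONLY: theorems; no `def`, no named fact, no instance, no notation (D-0014 ∕ D-0026
net debt `0`).  HC_CM is NOT proved here or anywhere in the lane.

## Mathematics

T. Kubota [Kubota1965] §4 Lemma 2 reduces the rank of a CM type `S ⊂ G` (finite abelian `G ∋ ρ`) to the vanishing of the odd character sums `χ(S)`;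
grouped by kernels `H = ker χ` (`G/H` cyclic, `ρ ∉ H`) all characters of kernel `H` vanish together (tree `AbelianKernels.forall_sum_char_eq_zero_iff_
exists`).  For `[G:H] = 4pq` (`p ≠ q` odd primes) write `G/H = ⟨w̄⟩ × ⟨ū⟩ × ⟨v̄⟩ ≅ ℤ/4 × ℤ/p × ℤ/q` with `χ(w) = i`, `χ(u) = μ`, `χ(v) = ν` (primitive
of orders `4, p, q`; `ρ̄ = w̄²`) and `N(c) = #(S ∩ cH)` the coset counts.  Every value of `χ` is `i^e μ^a ν^b`, so (F. Hazama's computation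
[Hazama2003CyclicCM] (4.1), with multiplicities, in GAUSSIAN COORDINATES)

  `χ(S) = V(E₀; μ, ν) + i·V(E₁; μ, ν)`,  `E₀(a,b) = N(ū^a v̄^b) − N(w̄² ū^a v̄^b)`,  `E₁(a,b) = N(w̄ ū^a v̄^b) − N(w̄³ ū^a v̄^b)` (`∈ ℤ`),

`V(E; μ, ν) = Σ_{a,b} E(a,b) μ^a ν^b`.  Since `i ∉ ℚ(μ, ν)` (else `ℚ(ζ_{4pq}) ⊆ ℚ(μ, ν)`, `φ(4pq) = 2(p−1)(q−1) > (p−1)(q−1) ≥ [ℚ(μ,ν):ℚ]`;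
[Washington1997] Prop. 2.4 ∕ Thm. 2.5 — §1, **`I_notMem_sup_adjoin`**), `χ(S) = 0` iff BOTH `V(E₀) = V(E₁) = 0`, i.e. (the `ℤ`-relations among
the `pq`-th roots of unity, F64i `pairSum_eq_zero_iff_forall_sub_eq`: Rédei ∕ de Bruijn ∕ Schoenberg, [Hazama2003CyclicCM] (4.6)) iff `E₀` AND `E₁` are
ADDITIVELY SEPARABLE (**`pairSum_add_I_mul_pairSum_eq_zero_iff`**, §1).  As `S` is a CM type, `N(w̄²c) = |H| − N(c)`, so `E₀ = 2N(ū^a v̄^b) − |H|`,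
`E₁ = 2N(w̄ ū^a v̄^b) − |H|`, and separability of `E₀, E₁` is separability of the coset counts from the base points `1, w̄` — equivalently from
`w̄², w̄³`, hence from EVERY base point (**`sum_char_eq_zero_iff_separable_of_index_four_mul_odd_primes`**, §2):

  `χ(S) = 0 ⟺ #(S ∩ gH) + #(S ∩ gxyH) = #(S ∩ gxH) + #(S ∩ gyH)` for all `g ∈ G`, `x` with `x^p ∈ H`, `y` with `y^q ∈ H`

— VERBATIM the condition of the index-`2pq` kernels (F64i), exactly as the index-`4p` condition repeats the index-`2p` one (lane F64b-1); and the
all-characters form **`forall_sum_char_eq_zero_iff_separable_of_index_four_mul_odd_primes`** (the kernel contributes `φ(4pq) = 2(p−1)(q−1)` to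
Kubota's defect iff so).

* §1 (namespace `CyclicCMType`): private `isPrimitiveRoot_I_four_fp`; **`I_notMem_sup_adjoin`** (`i ∉ ℚ(μ) ⊔ ℚ(ν)`, degrees via the tree's
  `CyclotomicGaussian.finrank_adjoin_eq_totient` and Mathlib's `IntermediateField.finrank_sup_le`), `eq_zero_of_add_I_mul_eq_zero_sup`, private
  `pairSum_mem_sup_fp`, **`pairSum_add_I_mul_pairSum_eq_zero_iff`**.
* §2 (namespace `CyclicCMType.AbelianKernels`) private: character algebra, `exists_values_of_index_fp` (elements with values `μ`, `ν`, `i`: powers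
  `4q`, `4p`, `pq` or `3pq` of a generator of `G/H`), `zmod_eq_of_value_eq_fp` (cancellation in `μ₄·μ_p·μ_q`: raise to the power `4q`); the
  parametrisation `Fin 4 × ℤ/p × ℤ/q → G/H` is a bijection, `χ(S) = Σ_t N(t)·F(t)` (`Finset.sum_fiberwise_of_maps_to`) `= V(E₀) + i·V(E₁)`; then §1,
  the complementary fibres (tree `AbelianPrimePow.card_filter_neg`, `card_fibre_mul`), and the dictionary value counts ↔ coset counts from any base point.

PRESEARCH (lane rule): as for F64i — the `±1`∕one-prime cases are Hazama's Lemma 4.6.1 and Prop. 4.3 (tree); corpus hybrid «vanishing character sum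
CM type kernel index 4pq Gaussian» and «rank of CM type abelian CM field exponent» (hits: DMOS LNM 900, GGK, Lang *Cyclotomic Fields*: no such statement),
galaxy «degenerate CM type | nondegenerate CM-type | rank of a CM type» (all stars: 0 relevant); the multiplicity∕Gaussian form of the criterion is not
found as printed; recorded as the lane's own elementary theorem with [Hazama2003CyclicCM] and [Washington1997] cited for the mechanism (the proof is
self-contained given F64i: degree count + Galois-free cancellation).

HONEST REGISTER.  Unconditional and elementary; nothing about degenerate types' Hodge classes; nothing is claimed about which index-`4pq` subgroups have
cyclic quotient (the sequel carries `IsCyclic (G ⧸ H)` explicitly).  HC_CM is NOT proved and not used.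

## References

* [Hazama2003CyclicCM] F. Hazama, *Hodge cycles on abelian varieties with complex multiplication by cyclic CM-fields*, J. Math. Sci. Univ. Tokyo 10
  (2003) 581–598: (4.1), Prop. 4.1, 4.3, Lemma 4.6.1 with (4.6)–(4.10), Thm. 4.8.
* [Washington1997] L. C. Washington, *Introduction to Cyclotomic Fields*, 2nd ed., GTM 83, Prop. 2.4, Thm. 2.5 (degrees of cyclotomic fields;
  `ℚ(ζ_m) ∩ ℚ(ζ_n)` for coprime conductors).
* [Kubota1965] T. Kubota, *On the field extension by complex multiplication*, Trans. AMS 118 (1965), §4 Lemma 2.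
* [White1993SporadicCycles] S. P. White, *Sporadic cycles on CM abelian varieties*, Compositio Math. 88 (1993), §4, proof of Lemma 3 (p. 131).

## Provenance

Cell `pub-hodgecm2` (COR-CM), KEPT Literature lane `lit-deligne-3` gen 65 (claim ABELIAN-KERNELS-INDEX-4PQ; count-neutral, own lane), file F65b;
neighbours cited by name, nothing restated: `DegenerateCMTypesAbelianKernelsIndexTwoOddPrimes` (F64i: `pairSum_eq_zero_iff_forall_sub_eq`; through it
`DegenerateCMTypesAbelianKernels` — `forall_sum_char_eq_zero_iff_exists`, `exists_oddChar_ker` — and `DegenerateCMTypesAbelianPrimePower` —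
`AbelianPrimePow.card_filter_neg`, `card_fibre_mul` — and `DegenerateCMTypesCyclicTwoOddPrimes` — `pairSum`), `NumberFields/CyclotomicGaussianIndependence`
(`finrank_adjoin_eq_totient`).  The `[folklore]` helpers are private (the character algebra is re-proved privately, as in each kernel file, since the
tree keeps it private).  Theorems only; net Literature debt 0.
-/

noncomputable section

open scoped BigOperators Classical

namespace Literature.NumberTheory.ComplexMultiplication

namespace CyclicCMType

open IntermediateField
open Literature.NumberTheory.NumberFields.CyclotomicGaussian (finrank_adjoin_eq_totient)

/-! ## §1 `i ∉ ℚ(μ) ⊔ ℚ(ν)`: Gaussian coordinates over the `pq`-th roots of unity -/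

section Gaussian

variable {p q : ℕ}

/-- `i` is a primitive fourth root of unity. [folklore] -/
private theorem isPrimitiveRoot_I_four_fp : IsPrimitiveRoot Complex.I 4 := by
  refine IsPrimitiveRoot.mk_of_lt Complex.I (by norm_num) Complex.I_pow_four fun l hl hl4 => ?_
  interval_cases l
  · rw [pow_one]; intro h; simpa using congrArg Complex.im h
  · rw [Complex.I_sq]; intro h; have := congrArg Complex.re h; norm_num at this
  · rw [pow_succ, Complex.I_sq]; intro h; simpa using congrArg Complex.im h

/-- **`i ∉ ℚ(μ) ⊔ ℚ(ν)`** for a primitive `p`-th root of unity `μ` and a primitive `q`-th root of unity `ν` (`p ≠ q` odd primes): else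
`ℚ(ζ_{4pq}) = ℚ(iμν) ⊆ ℚ(μ) ⊔ ℚ(ν)` and `2(p−1)(q−1) = φ(4pq) ≤ [ℚ(μ) ⊔ ℚ(ν) : ℚ] ≤ (p−1)(q−1)`.  (One prime: the tree's
`CyclotomicGaussian.I_notMem_adjoin`.) [cite: Washington1997, Prop. 2.4 and Thm. 2.5] -/
theorem I_notMem_sup_adjoin (hp : p.Prime) (hq : q.Prime) (hpq : p ≠ q) (hp2 : p ≠ 2) (hq2 : q ≠ 2) {μ ν : ℂ}
    (hμ : IsPrimitiveRoot μ p) (hν : IsPrimitiveRoot ν q) : Complex.I ∉ ℚ⟮μ⟯ ⊔ ℚ⟮ν⟯ := by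
  intro hI
  have hcop4p : Nat.Coprime 4 p := by
    rw [show (4 : ℕ) = 2 ^ 2 by norm_num]
    exact ((Nat.coprime_primes Nat.prime_two hp).2 (Ne.symm hp2)).pow_left 2
  have hcop4q : Nat.Coprime 4 q := by
    rw [show (4 : ℕ) = 2 ^ 2 by norm_num]
    exact ((Nat.coprime_primes Nat.prime_two hq).2 (Ne.symm hq2)).pow_left 2
  have hcoppq : Nat.Coprime p q := (Nat.coprime_primes hp hq).2 hpq
  -- `i μ ν` is a primitive `4pq`-th root of unity
  have hη : IsPrimitiveRoot (Complex.I * μ * ν) (4 * p * q) := by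
    have h4 : orderOf Complex.I = 4 := isPrimitiveRoot_I_four_fp.eq_orderOf.symm
    have hpo : orderOf μ = p := hμ.eq_orderOf.symm
    have hqo : orderOf ν = q := hν.eq_orderOf.symm
    have h1 : orderOf (Complex.I * μ) = 4 * p := by
      rw [(Commute.all _ _).orderOf_mul_eq_mul_orderOf_of_coprime (by rw [h4, hpo]; exact hcop4p), h4, hpo]
    rw [IsPrimitiveRoot.iff_orderOf,
      (Commute.all _ _).orderOf_mul_eq_mul_orderOf_of_coprime (by rw [h1, hqo]; exact Nat.Coprime.mul_left hcop4q hcoppq),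
      h1, hqo]
  haveI : FiniteDimensional ℚ ℚ⟮μ⟯ := adjoin.finiteDimensional ((hμ.isIntegral hp.pos).tower_top)
  haveI : FiniteDimensional ℚ ℚ⟮ν⟯ := adjoin.finiteDimensional ((hν.isIntegral hq.pos).tower_top)
  have hμmem : μ ∈ ℚ⟮μ⟯ ⊔ ℚ⟮ν⟯ := (le_sup_left : ℚ⟮μ⟯ ≤ ℚ⟮μ⟯ ⊔ ℚ⟮ν⟯) (mem_adjoin_simple_self ℚ μ)
  have hνmem : ν ∈ ℚ⟮μ⟯ ⊔ ℚ⟮ν⟯ := (le_sup_right : ℚ⟮ν⟯ ≤ ℚ⟮μ⟯ ⊔ ℚ⟮ν⟯) (mem_adjoin_simple_self ℚ ν)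
  have hle : ℚ⟮Complex.I * μ * ν⟯ ≤ ℚ⟮μ⟯ ⊔ ℚ⟮ν⟯ :=
    adjoin_simple_le_iff.2 (mul_mem (mul_mem hI hμmem) hνmem)
  have h4 : Nat.totient 4 = 2 := by decide
  have h := finrank_le_of_le_right hle
  rw [finrank_adjoin_eq_totient (Nat.mul_pos (Nat.mul_pos four_pos hp.pos) hq.pos) hη, Nat.totient_mul (Nat.Coprime.mul_left hcop4q hcoppq),
    Nat.totient_mul hcop4p, Nat.totient_prime hp, Nat.totient_prime hq, h4] at h
  have h2 := IntermediateField.finrank_sup_le ℚ⟮μ⟯ ℚ⟮ν⟯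
  rw [finrank_adjoin_eq_totient hp.pos hμ, finrank_adjoin_eq_totient hq.pos hν, Nat.totient_prime hp,
    Nat.totient_prime hq] at h2
  have hab : 1 ≤ (p - 1) * (q - 1) := Nat.one_le_iff_ne_zero.2 (Nat.mul_ne_zero (by have := hp.two_le; omega)
    (by have := hq.two_le; omega))
  have key : 2 * ((p - 1) * (q - 1)) ≤ (p - 1) * (q - 1) :=
    le_trans (le_of_eq (by ring)) (h.trans h2)
  omega

/-- `a + i·b = 0` with `a, b ∈ ℚ(μ) ⊔ ℚ(ν)` forces `a = b = 0`. [cite: Washington1997, Prop. 2.4] -/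
theorem eq_zero_of_add_I_mul_eq_zero_sup (hp : p.Prime) (hq : q.Prime) (hpq : p ≠ q) (hp2 : p ≠ 2) (hq2 : q ≠ 2)
    {μ ν : ℂ} (hμ : IsPrimitiveRoot μ p) (hν : IsPrimitiveRoot ν q) {a b : ℂ} (ha : a ∈ ℚ⟮μ⟯ ⊔ ℚ⟮ν⟯)
    (hb : b ∈ ℚ⟮μ⟯ ⊔ ℚ⟮ν⟯) (h : a + Complex.I * b = 0) : a = 0 ∧ b = 0 := by
  by_cases hb0 : b = 0
  · refine ⟨?_, hb0⟩
    rwa [hb0, mul_zero, add_zero] at h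
  · exfalso
    apply I_notMem_sup_adjoin hp hq hpq hp2 hq2 hμ hν
    have hI : Complex.I = -a / b := by
      field_simp
      linear_combination h
    rw [hI]
    exact div_mem (neg_mem ha) hb

/-- `V(ε; μ, ν) ∈ ℚ(μ) ⊔ ℚ(ν)` for an integer matrix `ε`. [folklore] -/
private theorem pairSum_mem_sup_fp [NeZero p] [NeZero q] (ε : ZMod p × ZMod q → ℤ) (μ ν : ℂ) :
    pairSum ε μ ν ∈ ℚ⟮μ⟯ ⊔ ℚ⟮ν⟯ := by
  have hμmem : μ ∈ ℚ⟮μ⟯ ⊔ ℚ⟮ν⟯ := (le_sup_left : ℚ⟮μ⟯ ≤ ℚ⟮μ⟯ ⊔ ℚ⟮ν⟯) (mem_adjoin_simple_self ℚ μ)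
  have hνmem : ν ∈ ℚ⟮μ⟯ ⊔ ℚ⟮ν⟯ := (le_sup_right : ℚ⟮ν⟯ ≤ ℚ⟮μ⟯ ⊔ ℚ⟮ν⟯) (mem_adjoin_simple_self ℚ ν)
  unfold pairSum
  exact sum_mem fun xy _ => mul_mem (intCast_mem _ _) (mul_mem (pow_mem hμmem _) (pow_mem hνmem _))

/-- **Gaussian coordinates**: `V(ε₀; μ, ν) + i·V(ε₁; μ, ν) = 0` for INTEGER matrices `ε₀, ε₁` on `ℤ/p × ℤ/q` iff both sums vanish
(`i ∉ ℚ(μ, ν)`), i.e. iff BOTH matrices are additively separable (the tree's `pairSum_eq_zero_iff_forall_sub_eq`).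
[cite: Washington1997, Prop. 2.4 and Thm. 2.5] [cite: Hazama2003CyclicCM, Lemma 4.6.1 and (4.6)–(4.10)] -/
theorem pairSum_add_I_mul_pairSum_eq_zero_iff [hp : Fact p.Prime] [hq : Fact q.Prime] (hpq : p ≠ q) (hp2 : p ≠ 2)
    (hq2 : q ≠ 2) {μ ν : ℂ} (hμ : IsPrimitiveRoot μ p) (hν : IsPrimitiveRoot ν q) (ε₀ ε₁ : ZMod p × ZMod q → ℤ) :
    haveI : NeZero p := ⟨hp.out.ne_zero⟩
    haveI : NeZero q := ⟨hq.out.ne_zero⟩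
    pairSum ε₀ μ ν + Complex.I * pairSum ε₁ μ ν = 0 ↔
      (∀ (x x' : ZMod p) (y y' : ZMod q), ε₀ (x, y) - ε₀ (x', y) = ε₀ (x, y') - ε₀ (x', y')) ∧
        ∀ (x x' : ZMod p) (y y' : ZMod q), ε₁ (x, y) - ε₁ (x', y) = ε₁ (x, y') - ε₁ (x', y') := by
  haveI : NeZero p := ⟨hp.out.ne_zero⟩
  haveI : NeZero q := ⟨hq.out.ne_zero⟩
  rw [← pairSum_eq_zero_iff_forall_sub_eq hpq hμ hν ε₀, ← pairSum_eq_zero_iff_forall_sub_eq hpq hμ hν ε₁]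
  constructor
  · intro h0
    exact eq_zero_of_add_I_mul_eq_zero_sup hp.out hq.out hpq hp2 hq2 hμ hν (pairSum_mem_sup_fp ε₀ μ ν)
      (pairSum_mem_sup_fp ε₁ μ ν) h0
  · rintro ⟨h0, h1⟩
    rw [h0, h1, mul_zero, add_zero]

end Gaussian

namespace AbelianKernels

variable {G : Type*} [CommGroup G] [Fintype G] [DecidableEq G] {ρ : G} {Φ : Finset G} {p q : ℕ}

/-! ## §0 Helpers -/

section Helpers

omit [Fintype G] [DecidableEq G] in
/-- `χ(gh) = χ(g)χ(h)`. [folklore] -/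
private theorem char_mul_fp (χ : AddChar (Additive G) ℂ) (g h : G) :
    χ (Additive.ofMul (g * h)) = χ (Additive.ofMul g) * χ (Additive.ofMul h) := by
  rw [ofMul_mul, AddChar.map_add_eq_mul]

omit [Fintype G] [DecidableEq G] in
/-- `χ(g^e) = χ(g)^e`. [folklore] -/
private theorem char_pow_fp (χ : AddChar (Additive G) ℂ) (g : G) (e : ℕ) :
    χ (Additive.ofMul (g ^ e)) = χ (Additive.ofMul g) ^ e := by
  rw [ofMul_pow, AddChar.map_nsmul_eq_pow]

omit [Fintype G] [DecidableEq G] in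
/-- `χ(1) = 1`. [folklore] -/
private theorem char_one_fp (χ : AddChar (Additive G) ℂ) : χ (Additive.ofMul (1 : G)) = 1 := by
  rw [ofMul_one, AddChar.map_zero_eq_one]

omit [Fintype G] [DecidableEq G] in
/-- `χ(g) ≠ 0`. [folklore] -/
private theorem char_ne_zero_fp (χ : AddChar (Additive G) ℂ) (g : G) : χ (Additive.ofMul g) ≠ 0 := by
  intro h0
  have := char_mul_fp χ g g⁻¹
  rw [mul_inv_cancel, char_one_fp, h0, zero_mul] at this
  exact one_ne_zero this

omit [Fintype G] [DecidableEq G] in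
/-- `χ(s) = χ(g)` iff `g⁻¹s ∈ ker χ`. [folklore] -/
private theorem char_eq_iff_inv_mul_mem_fp {H : Subgroup G} (χ : AddChar (Additive G) ℂ)
    (hker : ∀ g : G, χ (Additive.ofMul g) = 1 ↔ g ∈ H) (g s : G) :
    χ (Additive.ofMul s) = χ (Additive.ofMul g) ↔ g⁻¹ * s ∈ H := by
  rw [← hker]
  have h1 : χ (Additive.ofMul (g⁻¹ * s)) * χ (Additive.ofMul g) = χ (Additive.ofMul s) := by
    rw [← char_mul_fp, mul_comm g⁻¹ s, inv_mul_cancel_right]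
  constructor
  · intro hs
    rw [hs] at h1
    exact mul_left_eq_self₀.1 h1 |>.resolve_right (char_ne_zero_fp χ g)
  · intro h
    rw [h, one_mul] at h1
    exact h1.symm

omit [Fintype G] [DecidableEq G] in
/-- `ρ² = 1` for the conjugation of a CM type. [folklore] -/
private theorem rho_mul_rho_fp (h : IsCMTypeWith ρ (Φ : Set G)) : ρ * ρ = 1 := by
  simpa [smul_eq_mul] using h.invol (1 : G)

omit [Fintype G] [DecidableEq G] in
/-- A character whose kernel misses the involution `ρ` is odd. [folklore] -/
private theorem odd_of_ker_fp {H : Subgroup G} (hρH : ρ ∉ H) (hρ2 : ρ * ρ = 1) (χ : AddChar (Additive G) ℂ)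
    (hker : ∀ g : G, χ (Additive.ofMul g) = 1 ↔ g ∈ H) : χ (Additive.ofMul ρ) = -1 := by
  have hsq : χ (Additive.ofMul ρ) * χ (Additive.ofMul ρ) = 1 := by rw [← char_mul_fp, hρ2, char_one_fp]
  rcases mul_self_eq_one_iff.1 hsq with h1 | h1
  · exact absurd ((hker ρ).1 h1) hρH
  · exact h1

omit [Fintype G] [DecidableEq G] in
/-- For `ker χ` of index `4pq` with cyclic quotient there are elements whose `χ`-values are a primitive `p`-th root of unity, a
primitive `q`-th root of unity, and `i`. [folklore] -/
private theorem exists_values_of_index_fp [Finite G] [hp : Fact p.Prime] [hq : Fact q.Prime] {H : Subgroup G}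
    (χ : AddChar (Additive G) ℂ) (hker : ∀ g : G, χ (Additive.ofMul g) = 1 ↔ g ∈ H) (hidx : H.index = 4 * (p * q))
    (hcyc : IsCyclic (G ⧸ H)) :
    (∃ u : G, IsPrimitiveRoot (χ (Additive.ofMul u)) p) ∧ (∃ v : G, IsPrimitiveRoot (χ (Additive.ofMul v)) q) ∧
      ∃ w : G, χ (Additive.ofMul w) = Complex.I := by
  haveI := hcyc
  obtain ⟨γ, hγ⟩ := IsCyclic.exists_generator (α := G ⧸ H)
  obtain ⟨σ, rfl⟩ := QuotientGroup.mk_surjective γ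
  have hσN : orderOf (σ : G ⧸ H) = 4 * (p * q) := by
    rw [orderOf_eq_card_of_forall_mem_zpowers hγ, ← Subgroup.index_eq_card, hidx]
  have hprim : IsPrimitiveRoot (χ (Additive.ofMul σ)) (4 * (p * q)) := by
    rw [IsPrimitiveRoot.iff_def]
    have hk : ∀ k : ℕ, χ (Additive.ofMul σ) ^ k = 1 ↔ 4 * (p * q) ∣ k := fun k => by
      rw [← char_pow_fp, hker, ← QuotientGroup.eq_one_iff, QuotientGroup.mk_pow, ← hσN, orderOf_dvd_iff_pow_eq_one]
    exact ⟨(hk _).2 dvd_rfl, fun l hl => (hk l).1 hl⟩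
  have hpos : 0 < 4 * (p * q) := Nat.mul_pos four_pos (Nat.mul_pos hp.out.pos hq.out.pos)
  refine ⟨⟨σ ^ (4 * q), ?_⟩, ⟨σ ^ (4 * p), ?_⟩, ?_⟩
  · rw [char_pow_fp]
    exact hprim.pow hpos (by ring)
  · rw [char_pow_fp]
    exact hprim.pow hpos (by ring)
  · have hε4 : IsPrimitiveRoot (χ (Additive.ofMul σ) ^ (p * q)) 4 := hprim.pow hpos (by ring)
    have hne : (χ (Additive.ofMul σ) ^ (p * q)) ^ 2 ≠ 1 := hε4.pow_ne_one_of_pos_of_lt two_ne_zero (by norm_num)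
    have hsq4 : (χ (Additive.ofMul σ) ^ (p * q)) ^ 2 * (χ (Additive.ofMul σ) ^ (p * q)) ^ 2 = 1 := by
      rw [← pow_add]
      exact hε4.pow_eq_one
    have hε2 : (χ (Additive.ofMul σ) ^ (p * q)) ^ 2 = -1 :=
      (mul_self_eq_one_iff.1 hsq4).resolve_left hne
    have h0 : (χ (Additive.ofMul σ) ^ (p * q) - Complex.I) * (χ (Additive.ofMul σ) ^ (p * q) + Complex.I) = 0 := by
      linear_combination hε2 - Complex.I_sq
    rcases mul_eq_zero.1 h0 with h1 | h1
    · exact ⟨σ ^ (p * q), by rw [char_pow_fp, sub_eq_zero.1 h1]⟩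
    · refine ⟨σ ^ (3 * (p * q)), ?_⟩
      rw [char_pow_fp, pow_mul', eq_neg_of_add_eq_zero_left h1, neg_pow, Complex.I_pow_three]
      norm_num

/-- `ω^{(x + y).val} = ω^{x.val} ω^{y.val}` for `ω` a primitive `n`-th root of unity. [folklore] -/
private theorem pow_val_add_fp {n : ℕ} [NeZero n] {ω : ℂ} (hω : IsPrimitiveRoot ω n) (x y : ZMod n) :
    ω ^ (x + y).val = ω ^ x.val * ω ^ y.val := by
  have h1 := pow_mod_orderOf ω (x.val + y.val)
  rw [← hω.eq_orderOf] at h1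
  rw [ZMod.val_add, h1, pow_add]

/-- **Cancellation in `μ₄ · μ_p · μ_q`**: `i^e μ^a ν^b = i^{e'} μ^{a'} ν^{b'}` forces `a = a'` (raise to the power `4q`, which is invertible
modulo `p`). [folklore] -/
private theorem zmod_eq_of_value_eq_fp [hp : Fact p.Prime] [hq : Fact q.Prime] (hpq : p ≠ q) (hp2 : p ≠ 2) {μ ν : ℂ}
    (hμ : IsPrimitiveRoot μ p) (hν : IsPrimitiveRoot ν q) {e e' : ℕ} {a a' : ZMod p} {b b' : ZMod q}
    (h : Complex.I ^ e * (μ ^ a.val * ν ^ b.val) = Complex.I ^ e' * (μ ^ a'.val * ν ^ b'.val)) : a = a' := by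
  have hkill : ∀ (f : ℕ) (c : ZMod p) (d : ZMod q), (Complex.I ^ f * (μ ^ c.val * ν ^ d.val)) ^ (4 * q) = μ ^ (4 * q * c.val) := by
    intro f c d
    have A : (Complex.I ^ f) ^ (4 * q) = 1 := by
      rw [← pow_mul, show f * (4 * q) = 4 * (f * q) by ring, pow_mul, Complex.I_pow_four, one_pow]
    have B : (ν ^ d.val) ^ (4 * q) = 1 := by
      rw [← pow_mul, show d.val * (4 * q) = q * (4 * d.val) by ring, pow_mul, hν.pow_eq_one, one_pow]
    have C : (μ ^ c.val) ^ (4 * q) = μ ^ (4 * q * c.val) := by rw [← pow_mul, mul_comm]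
    rw [mul_pow, mul_pow, A, B, C, one_mul, mul_one]
  have h2 : μ ^ (4 * q * a.val) = μ ^ (4 * q * a'.val) := by rw [← hkill e a b, ← hkill e' a' b', h]
  have hmod : 4 * q * a.val ≡ 4 * q * a'.val [MOD p] := by
    have h1 := pow_mod_orderOf μ (4 * q * a.val)
    have h1' := pow_mod_orderOf μ (4 * q * a'.val)
    rw [← hμ.eq_orderOf] at h1 h1'
    rw [← h1, ← h1'] at h2
    exact hμ.pow_inj (Nat.mod_lt _ hp.out.pos) (Nat.mod_lt _ hp.out.pos) h2
  have hz : ((4 * q * a.val : ℕ) : ZMod p) = ((4 * q * a'.val : ℕ) : ZMod p) := (ZMod.natCast_eq_natCast_iff _ _ _).2 hmod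
  push_cast at hz
  rw [ZMod.natCast_zmod_val, ZMod.natCast_zmod_val] at hz
  have hu : IsUnit ((4 * q : ℕ) : ZMod p) := by
    rw [ZMod.isUnit_iff_coprime]
    refine Nat.Coprime.mul_left ?_ ((Nat.coprime_primes hq.out hp.out).2 (Ne.symm hpq))
    rw [show (4 : ℕ) = 2 ^ 2 by norm_num]
    exact ((Nat.coprime_primes Nat.prime_two hp.out).2 (Ne.symm hp2)).pow_left 2
  have hu' : IsUnit ((4 : ZMod p) * (q : ZMod p)) := by exact_mod_cast hu
  exact hu'.mul_left_cancel hz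

end Helpers

/-! ## §2 Kernels of index `4pq`: the character sum as `V(E₀; μ, ν) + i·V(E₁; μ, ν)` and the vanishing criterion -/

section IndexFourTwoOddPrimes

variable [hp : Fact p.Prime] [hq : Fact q.Prime]

/-- **VANISHING AT A KERNEL OF INDEX `4pq` IS ADDITIVE SEPARABILITY OF THE COSET COUNTS** (any finite abelian group `G ∋ ρ`, `p ≠ q` odd
primes): let `χ` be a character whose kernel `H ∌ ρ` has index `4pq` and CYCLIC quotient, and `S` a CM type.  Then `χ(S) = 0` iff

  `#(S ∩ gH) + #(S ∩ gxyH) = #(S ∩ gxH) + #(S ∩ gyH)`  for all `g ∈ G`, all `x` with `x^p ∈ H` and all `y` with `y^q ∈ H`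

— VERBATIM the condition of the index-`2pq` kernels (the lane's `…separable_of_index_two_mul_odd_primes`): on `G/H ≅ ℤ/4 × ℤ/p × ℤ/q` the
coset counts of `S` have no interaction term along the odd part, from EVERY base point.  Mechanism: with `χ(w) = i`, `χ(u) = μ`, `χ(v) = ν`
(primitive of orders `4, p, q`) every value is `i^e μ^a ν^b` and `χ(S) = V(E₀; μ, ν) + i·V(E₁; μ, ν)`, `E₀(a,b) = N(μ^aν^b) − N(−μ^aν^b)`,
`E₁(a,b) = N(iμ^aν^b) − N(−iμ^aν^b)`; since `i ∉ ℚ(μ, ν)` (§1) both Gaussian coordinates vanish, i.e. (the tree's `ℤ`-relations among the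
`pq`-th roots of unity, F64i `pairSum_eq_zero_iff_forall_sub_eq`) `E₀` AND `E₁` are additively separable; with `N(−z) = #χ⁻¹(z) − N(z)`
(`S ⊔ ρS = G`) this is separability of the coset counts from the base points `1, w, w², w³`, hence from every base point.  (One prime: the
lane's index-`4p` decision `…equidistributed_of_index_four_mul`.) [cite: Hazama2003CyclicCM, Prop. 4.1, Lemma 4.6.1 and Thm. 4.8]
[cite: Washington1997, Prop. 2.4 and Thm. 2.5] [cite: Kubota1965, §4 Lemma 2] -/
theorem sum_char_eq_zero_iff_separable_of_index_four_mul_odd_primes (hpq : p ≠ q) (hp2 : p ≠ 2) (hq2 : q ≠ 2)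
    (h : IsCMTypeWith ρ (Φ : Set G)) (χ : AddChar (Additive G) ℂ) {H : Subgroup G} (hρH : ρ ∉ H)
    (hker : ∀ g : G, χ (Additive.ofMul g) = 1 ↔ g ∈ H) (hidx : H.index = 4 * (p * q)) (hcyc : IsCyclic (G ⧸ H)) :
    ∑ s ∈ Φ, χ (Additive.ofMul s) = 0 ↔ ∀ g x y : G, x ^ p ∈ H → y ^ q ∈ H →
      (Φ.filter fun s => g⁻¹ * s ∈ H).card + (Φ.filter fun s => (g * x * y)⁻¹ * s ∈ H).card =
        (Φ.filter fun s => (g * x)⁻¹ * s ∈ H).card + (Φ.filter fun s => (g * y)⁻¹ * s ∈ H).card := by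
  haveI : NeZero p := ⟨hp.out.ne_zero⟩
  haveI : NeZero q := ⟨hq.out.ne_zero⟩
  have hρ2 := rho_mul_rho_fp h
  have hχρ : χ (Additive.ofMul ρ) = -1 := odd_of_ker_fp hρH hρ2 χ hker
  obtain ⟨⟨u, hu⟩, ⟨v, hv⟩, ⟨w₄, hw₄⟩⟩ := exists_values_of_index_fp χ hker hidx hcyc
  have hμ0 : ∀ a : ℕ, χ (Additive.ofMul u) ^ a ≠ 0 := fun a => pow_ne_zero _ (char_ne_zero_fp χ u)
  have hν0 : ∀ b : ℕ, χ (Additive.ofMul v) ^ b ≠ 0 := fun b => pow_ne_zero _ (char_ne_zero_fp χ v)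
  -- the coset counts as value counts
  have hcos : ∀ g : G, (Φ.filter fun s => g⁻¹ * s ∈ H) =
      Φ.filter fun s => χ (Additive.ofMul s) = χ (Additive.ofMul g) := fun g =>
    Finset.filter_congr fun s _ => (char_eq_iff_inv_mul_mem_fp χ hker g s).symm
  have hNc : ∀ g g' : G, χ (Additive.ofMul g) = χ (Additive.ofMul g') →
      (Φ.filter fun s => g⁻¹ * s ∈ H).card = (Φ.filter fun s => g'⁻¹ * s ∈ H).card := fun g g' hgg' => by
    rw [hcos, hcos, hgg']
  -- the values `χ(w^e u^a v^b) = i^e μ^a ν^b`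
  have hval : ∀ (e : ℕ) (a : ZMod p) (b : ZMod q), χ (Additive.ofMul (w₄ ^ e * (u ^ a.val * v ^ b.val))) =
      Complex.I ^ e * (χ (Additive.ofMul u) ^ a.val * χ (Additive.ofMul v) ^ b.val) := fun e a b => by
    rw [char_mul_fp, char_pow_fp, hw₄, char_mul_fp, char_pow_fp, char_pow_fp]
  -- the fibre sizes over the values are all `M := #χ⁻¹(1)`, and `S` meets opposite fibres complementarily
  have hM : ∀ (e : ℕ) (a : ZMod p) (b : ZMod q),
      (Finset.univ.filter fun t : G => χ (Additive.ofMul t) =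
        Complex.I ^ e * (χ (Additive.ofMul u) ^ a.val * χ (Additive.ofMul v) ^ b.val)).card =
        (Finset.univ.filter fun t : G => χ (Additive.ofMul t) = 1).card := fun e a b => by
    rw [← hval, ← AbelianPrimePow.card_fibre_mul χ (w₄ ^ e * (u ^ a.val * v ^ b.val)) 1, mul_one]
  have hle : ∀ (e : ℕ) (a : ZMod p) (b : ZMod q),
      (Φ.filter fun s => χ (Additive.ofMul s) =
        Complex.I ^ e * (χ (Additive.ofMul u) ^ a.val * χ (Additive.ofMul v) ^ b.val)).card ≤
        (Finset.univ.filter fun t : G => χ (Additive.ofMul t) = 1).card := fun e a b => by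
    rw [← hM e a b]
    exact Finset.card_le_card (Finset.filter_subset_filter _ (Finset.subset_univ Φ))
  have hshift : ∀ (e : ℕ) (a : ZMod p) (b : ZMod q),
      (Φ.filter fun s => χ (Additive.ofMul s) =
        Complex.I ^ (e + 2) * (χ (Additive.ofMul u) ^ a.val * χ (Additive.ofMul v) ^ b.val)).card =
        (Finset.univ.filter fun t : G => χ (Additive.ofMul t) = 1).card -
          (Φ.filter fun s => χ (Additive.ofMul s) =
            Complex.I ^ e * (χ (Additive.ofMul u) ^ a.val * χ (Additive.ofMul v) ^ b.val)).card := by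
    intro e a b
    have hv2 : Complex.I ^ (e + 2) * (χ (Additive.ofMul u) ^ a.val * χ (Additive.ofMul v) ^ b.val) =
        -(Complex.I ^ e * (χ (Additive.ofMul u) ^ a.val * χ (Additive.ofMul v) ^ b.val)) := by
      rw [pow_add, Complex.I_sq]; ring
    rw [hv2, AbelianPrimePow.card_filter_neg h χ hχρ, hM]
  -- §A  the parametrisation of `G/H` by `Fin 4 × ℤ/p × ℤ/q` and the character sum over the value fibres
  set wf : Fin 4 × ZMod p × ZMod q → G := fun t => w₄ ^ (t.1 : ℕ) * (u ^ t.2.1.val * v ^ t.2.2.val) with hwf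
  set F : Fin 4 × ZMod p × ZMod q → ℂ := fun t =>
    Complex.I ^ (t.1 : ℕ) * (χ (Additive.ofMul u) ^ t.2.1.val * χ (Additive.ofMul v) ^ t.2.2.val) with hF
  have hFw : ∀ t, χ (Additive.ofMul (wf t)) = F t := fun t => by
    rw [hwf, hF]
    exact hval _ _ _
  have hFinj : Function.Injective F := by
    rintro ⟨e, a, b⟩ ⟨e', a', b'⟩ hFF
    rw [hF] at hFF
    dsimp only at hFF
    have ha : a = a' := zmod_eq_of_value_eq_fp hpq hp2 hu hv hFF
    have hb : b = b' := by
      have hFF' : Complex.I ^ (e : ℕ) * (χ (Additive.ofMul v) ^ b.val * χ (Additive.ofMul u) ^ a.val) =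
          Complex.I ^ (e' : ℕ) * (χ (Additive.ofMul v) ^ b'.val * χ (Additive.ofMul u) ^ a'.val) := by
        rw [mul_comm (χ (Additive.ofMul v) ^ b.val), mul_comm (χ (Additive.ofMul v) ^ b'.val)]
        exact hFF
      exact zmod_eq_of_value_eq_fp (Ne.symm hpq) hq2 hv hu hFF'
    subst ha; subst hb
    have hε : Complex.I ^ (e : ℕ) = Complex.I ^ (e' : ℕ) :=
      mul_right_cancel₀ (mul_ne_zero (hμ0 _) (hν0 _)) hFF
    have hee : (e : ℕ) = e' := isPrimitiveRoot_I_four_fp.pow_inj e.isLt e'.isLt hε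
    rw [Fin.ext hee]
  have hwinj : Function.Injective (fun t => (wf t : G ⧸ H)) := by
    intro t t' htt
    have hmem : (wf t)⁻¹ * wf t' ∈ H := QuotientGroup.eq.1 htt
    have hχeq : χ (Additive.ofMul (wf t')) = χ (Additive.ofMul (wf t)) := (char_eq_iff_inv_mul_mem_fp χ hker _ _).2 hmem
    rw [hFw, hFw] at hχeq
    exact (hFinj hχeq).symm
  have hcard : Fintype.card (Fin 4 × ZMod p × ZMod q) = Fintype.card (G ⧸ H) := by
    rw [← Nat.card_eq_fintype_card (α := G ⧸ H), ← Subgroup.index_eq_card, hidx]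
    simp [Fintype.card_prod, ZMod.card]
  have hwbij : Function.Bijective (fun t => (wf t : G ⧸ H)) :=
    (Fintype.bijective_iff_injective_and_card _).2 ⟨hwinj, hcard⟩
  have hexists : ∀ s : G, ∃ t, χ (Additive.ofMul s) = F t := fun s => by
    obtain ⟨t, ht⟩ := hwbij.2 (s : G ⧸ H)
    refine ⟨t, ?_⟩
    rw [← hFw]
    exact (char_eq_iff_inv_mul_mem_fp χ hker (wf t) s).2 (QuotientGroup.eq.1 ht)
  have hsumF : ∑ s ∈ Φ, χ (Additive.ofMul s) =
      ∑ t : Fin 4 × ZMod p × ZMod q, ((Φ.filter fun s => χ (Additive.ofMul s) = F t).card : ℂ) * F t := by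
    rw [← Finset.sum_fiberwise_of_maps_to (s := Φ) (t := Finset.univ)
      (g := fun s => Classical.choose (hexists s)) (fun s _ => Finset.mem_univ _) (fun s => χ (Additive.ofMul s))]
    refine Finset.sum_congr rfl fun t _ => ?_
    have hfib : (Φ.filter fun s => Classical.choose (hexists s) = t) = Φ.filter fun s => χ (Additive.ofMul s) = F t := by
      refine Finset.filter_congr fun s _ => ⟨fun hs => ?_, fun hs => ?_⟩
      · rw [← hs]; exact Classical.choose_spec (hexists s)
      · exact hFinj ((Classical.choose_spec (hexists s)).symm.trans hs)
    rw [hfib, Finset.sum_congr rfl fun s hs => (Finset.mem_filter.1 hs).2, Finset.sum_const, nsmul_eq_mul]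
  -- the two Gaussian coordinates `E₀ = N(·) − N(−·)`, `E₁ = N(i·) − N(−i·)` (as differences `D e` of value counts)
  obtain ⟨D, hD⟩ : ∃ D : ℕ → ZMod p → ZMod q → ℤ, ∀ (e : ℕ) (a : ZMod p) (b : ZMod q), D e a b =
      ((Φ.filter fun s => χ (Additive.ofMul s) =
          Complex.I ^ e * (χ (Additive.ofMul u) ^ a.val * χ (Additive.ofMul v) ^ b.val)).card : ℤ) -
        ((Φ.filter fun s => χ (Additive.ofMul s) =
          Complex.I ^ (e + 2) * (χ (Additive.ofMul u) ^ a.val * χ (Additive.ofMul v) ^ b.val)).card : ℤ) :=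
    ⟨fun e a b => ((Φ.filter fun s => χ (Additive.ofMul s) =
          Complex.I ^ e * (χ (Additive.ofMul u) ^ a.val * χ (Additive.ofMul v) ^ b.val)).card : ℤ) -
        ((Φ.filter fun s => χ (Additive.ofMul s) =
          Complex.I ^ (e + 2) * (χ (Additive.ofMul u) ^ a.val * χ (Additive.ofMul v) ^ b.val)).card : ℤ),
      fun _ _ _ => rfl⟩
  have hpair : ∑ s ∈ Φ, χ (Additive.ofMul s) =
      pairSum (fun ab => D 0 ab.1 ab.2) (χ (Additive.ofMul u)) (χ (Additive.ofMul v)) +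
        Complex.I * pairSum (fun ab => D 1 ab.1 ab.2) (χ (Additive.ofMul u)) (χ (Additive.ofMul v)) := by
    rw [hsumF, Fintype.sum_prod_type, Fin.sum_univ_four]
    unfold pairSum
    rw [Finset.mul_sum, ← Finset.sum_add_distrib, ← Finset.sum_add_distrib, ← Finset.sum_add_distrib,
      ← Finset.sum_add_distrib]
    refine Finset.sum_congr rfl fun ab _ => ?_
    dsimp only
    rw [hD, hD, hF]
    dsimp only
    have h0 : ((0 : Fin 4) : ℕ) = 0 := rfl
    have h1 : ((1 : Fin 4) : ℕ) = 1 := rfl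
    have h2 : ((2 : Fin 4) : ℕ) = 2 := rfl
    have h3 : ((3 : Fin 4) : ℕ) = 3 := rfl
    push_cast
    simp only [h0, h1, h2, h3, pow_zero, pow_one, one_mul, Complex.I_sq, Complex.I_pow_three, neg_one_mul]
    ring
  -- §B  `χ(S) = 0` iff both coordinates are additively separable, i.e. iff the counts `N(μ^aν^b)`, `N(iμ^aν^b)` are
  rw [hpair, pairSum_add_I_mul_pairSum_eq_zero_iff hpq hp2 hq2 hu hv]
  dsimp only
  have hDval : ∀ (e : ℕ) (a : ZMod p) (b : ZMod q), D e a b =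
      2 * ((Φ.filter fun s => χ (Additive.ofMul s) =
          Complex.I ^ e * (χ (Additive.ofMul u) ^ a.val * χ (Additive.ofMul v) ^ b.val)).card : ℤ) -
        ((Finset.univ.filter fun t : G => χ (Additive.ofMul t) = 1).card : ℤ) := by
    intro e a b
    rw [hD]
    have h1 := hshift e a b
    have h2 := hle e a b
    omega
  have hsepE : ∀ e : ℕ, (∀ (x x' : ZMod p) (y y' : ZMod q), D e x y - D e x' y = D e x y' - D e x' y') ↔
      ∀ (x x' : ZMod p) (y y' : ZMod q),
        (Φ.filter fun s => χ (Additive.ofMul s) =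
            Complex.I ^ e * (χ (Additive.ofMul u) ^ x.val * χ (Additive.ofMul v) ^ y.val)).card +
          (Φ.filter fun s => χ (Additive.ofMul s) =
            Complex.I ^ e * (χ (Additive.ofMul u) ^ x'.val * χ (Additive.ofMul v) ^ y'.val)).card =
        (Φ.filter fun s => χ (Additive.ofMul s) =
            Complex.I ^ e * (χ (Additive.ofMul u) ^ x'.val * χ (Additive.ofMul v) ^ y.val)).card +
          (Φ.filter fun s => χ (Additive.ofMul s) =
            Complex.I ^ e * (χ (Additive.ofMul u) ^ x.val * χ (Additive.ofMul v) ^ y'.val)).card := by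
    intro e
    refine forall_congr' fun x => forall_congr' fun x' => forall_congr' fun y => forall_congr' fun y' => ?_
    rw [hDval, hDval, hDval, hDval]
    omega
  -- the separability of the counts for `e + 2` from that for `e` (opposite fibres are complementary)
  have hsep_shift : ∀ e : ℕ, (∀ (x x' : ZMod p) (y y' : ZMod q),
        (Φ.filter fun s => χ (Additive.ofMul s) =
            Complex.I ^ e * (χ (Additive.ofMul u) ^ x.val * χ (Additive.ofMul v) ^ y.val)).card +
          (Φ.filter fun s => χ (Additive.ofMul s) =
            Complex.I ^ e * (χ (Additive.ofMul u) ^ x'.val * χ (Additive.ofMul v) ^ y'.val)).card =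
        (Φ.filter fun s => χ (Additive.ofMul s) =
            Complex.I ^ e * (χ (Additive.ofMul u) ^ x'.val * χ (Additive.ofMul v) ^ y.val)).card +
          (Φ.filter fun s => χ (Additive.ofMul s) =
            Complex.I ^ e * (χ (Additive.ofMul u) ^ x.val * χ (Additive.ofMul v) ^ y'.val)).card) →
      ∀ (x x' : ZMod p) (y y' : ZMod q),
        (Φ.filter fun s => χ (Additive.ofMul s) =
            Complex.I ^ (e + 2) * (χ (Additive.ofMul u) ^ x.val * χ (Additive.ofMul v) ^ y.val)).card +
          (Φ.filter fun s => χ (Additive.ofMul s) =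
            Complex.I ^ (e + 2) * (χ (Additive.ofMul u) ^ x'.val * χ (Additive.ofMul v) ^ y'.val)).card =
        (Φ.filter fun s => χ (Additive.ofMul s) =
            Complex.I ^ (e + 2) * (χ (Additive.ofMul u) ^ x'.val * χ (Additive.ofMul v) ^ y.val)).card +
          (Φ.filter fun s => χ (Additive.ofMul s) =
            Complex.I ^ (e + 2) * (χ (Additive.ofMul u) ^ x.val * χ (Additive.ofMul v) ^ y'.val)).card := by
    intro e hs x x' y y'
    have k := hs x x' y y'
    rw [hshift, hshift, hshift, hshift]
    have l1 := hle e x y; have l2 := hle e x' y'; have l3 := hle e x' y; have l4 := hle e x y'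
    omega
  rw [hsepE 0, hsepE 1]
  -- §C  value counts versus coset counts from an arbitrary base point
  have hbase : ∀ (g : G) (e : ℕ) (a₀ : ZMod p) (b₀ : ZMod q),
      χ (Additive.ofMul g) = Complex.I ^ e * (χ (Additive.ofMul u) ^ a₀.val * χ (Additive.ofMul v) ^ b₀.val) →
      ∀ (a : ZMod p) (b : ZMod q),
        (Φ.filter fun s => (g * (u ^ a.val * v ^ b.val))⁻¹ * s ∈ H).card =
          (Φ.filter fun s => χ (Additive.ofMul s) =
            Complex.I ^ e * (χ (Additive.ofMul u) ^ (a₀ + a).val * χ (Additive.ofMul v) ^ (b₀ + b).val)).card := by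
    intro g e a₀ b₀ hg a b
    rw [hcos, char_mul_fp, hg, char_mul_fp, char_pow_fp, char_pow_fp, pow_val_add_fp hu, pow_val_add_fp hv]
    congr 1
    refine Finset.filter_congr fun s _ => ?_
    rw [show Complex.I ^ e * (χ (Additive.ofMul u) ^ a₀.val * χ (Additive.ofMul v) ^ b₀.val) *
        (χ (Additive.ofMul u) ^ a.val * χ (Additive.ofMul v) ^ b.val) =
      Complex.I ^ e * (χ (Additive.ofMul u) ^ a₀.val * χ (Additive.ofMul u) ^ a.val *
        (χ (Additive.ofMul v) ^ b₀.val * χ (Additive.ofMul v) ^ b.val)) by ring]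
  constructor
  · -- separability of the two coordinates ⟹ the coset condition
    rintro ⟨hs0, hs1⟩ g x y hx hy
    have hsepAll : ∀ e : ℕ, e < 4 → ∀ (x x' : ZMod p) (y y' : ZMod q),
        (Φ.filter fun s => χ (Additive.ofMul s) =
            Complex.I ^ e * (χ (Additive.ofMul u) ^ x.val * χ (Additive.ofMul v) ^ y.val)).card +
          (Φ.filter fun s => χ (Additive.ofMul s) =
            Complex.I ^ e * (χ (Additive.ofMul u) ^ x'.val * χ (Additive.ofMul v) ^ y'.val)).card =
        (Φ.filter fun s => χ (Additive.ofMul s) =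
            Complex.I ^ e * (χ (Additive.ofMul u) ^ x'.val * χ (Additive.ofMul v) ^ y.val)).card +
          (Φ.filter fun s => χ (Additive.ofMul s) =
            Complex.I ^ e * (χ (Additive.ofMul u) ^ x.val * χ (Additive.ofMul v) ^ y'.val)).card := by
      intro e he
      interval_cases e
      · exact hs0
      · exact hs1
      · exact hsep_shift 0 hs0
      · exact hsep_shift 1 hs1
    -- `χ(x) = μ^i`, `χ(y) = ν^j`, `χ(g) = i^e μ^{a₀} ν^{b₀}`
    have hxp : χ (Additive.ofMul x) ^ p = 1 := by rw [← char_pow_fp, hker]; exact hx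
    have hyq : χ (Additive.ofMul y) ^ q = 1 := by rw [← char_pow_fp, hker]; exact hy
    obtain ⟨i, hi, hix⟩ := hu.eq_pow_of_pow_eq_one hxp
    obtain ⟨j, hj, hjy⟩ := hv.eq_pow_of_pow_eq_one hyq
    have hiv : χ (Additive.ofMul x) = χ (Additive.ofMul (u ^ ((i : ZMod p)).val * v ^ (0 : ZMod q).val)) := by
      rw [ZMod.val_natCast_of_lt hi, ZMod.val_zero, pow_zero, mul_one, char_pow_fp, hix]
    have hjv : χ (Additive.ofMul y) = χ (Additive.ofMul (u ^ (0 : ZMod p).val * v ^ ((j : ZMod q)).val)) := by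
      rw [ZMod.val_natCast_of_lt hj, ZMod.val_zero, pow_zero, one_mul, char_pow_fp, hjy]
    have hijv : χ (Additive.ofMul (x * y)) = χ (Additive.ofMul (u ^ ((i : ZMod p)).val * v ^ ((j : ZMod q)).val)) := by
      rw [char_mul_fp, hiv, hjv, ← char_mul_fp, ZMod.val_zero, ZMod.val_zero, pow_zero, pow_zero, mul_one, one_mul]
    obtain ⟨⟨e, a₀, b₀⟩, ht⟩ := hexists g
    rw [hF] at ht
    dsimp only at ht
    have k := hsepAll e e.isLt (a₀ + 0) (a₀ + (i : ZMod p)) (b₀ + 0) (b₀ + (j : ZMod q))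
    rw [← hbase g e a₀ b₀ ht, ← hbase g e a₀ b₀ ht, ← hbase g e a₀ b₀ ht, ← hbase g e a₀ b₀ ht] at k
    have e1 : (Φ.filter fun s => g⁻¹ * s ∈ H).card =
        (Φ.filter fun s => (g * (u ^ (0 : ZMod p).val * v ^ (0 : ZMod q).val))⁻¹ * s ∈ H).card :=
      hNc _ _ (by rw [ZMod.val_zero, ZMod.val_zero, pow_zero, pow_zero, mul_one, mul_one])
    have e2 : (Φ.filter fun s => (g * x * y)⁻¹ * s ∈ H).card =
        (Φ.filter fun s => (g * (u ^ ((i : ZMod p)).val * v ^ ((j : ZMod q)).val))⁻¹ * s ∈ H).card :=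
      hNc _ _ (by rw [mul_assoc, char_mul_fp, hijv, ← char_mul_fp])
    have e3 : (Φ.filter fun s => (g * x)⁻¹ * s ∈ H).card =
        (Φ.filter fun s => (g * (u ^ ((i : ZMod p)).val * v ^ (0 : ZMod q).val))⁻¹ * s ∈ H).card :=
      hNc _ _ (by rw [char_mul_fp, hiv, ← char_mul_fp])
    have e4 : (Φ.filter fun s => (g * y)⁻¹ * s ∈ H).card =
        (Φ.filter fun s => (g * (u ^ (0 : ZMod p).val * v ^ ((j : ZMod q)).val))⁻¹ * s ∈ H).card :=
      hNc _ _ (by rw [char_mul_fp, hjv, ← char_mul_fp])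
    rw [e1, e2, e3, e4]
    exact k
  · -- the coset condition ⟹ separability of the two coordinates (base points `1` and `w`)
    intro hcoset
    have hsepOf : ∀ (g : G) (e : ℕ), χ (Additive.ofMul g) = Complex.I ^ e →
        ∀ (x x' : ZMod p) (y y' : ZMod q),
        (Φ.filter fun s => χ (Additive.ofMul s) =
            Complex.I ^ e * (χ (Additive.ofMul u) ^ x.val * χ (Additive.ofMul v) ^ y.val)).card +
          (Φ.filter fun s => χ (Additive.ofMul s) =
            Complex.I ^ e * (χ (Additive.ofMul u) ^ x'.val * χ (Additive.ofMul v) ^ y'.val)).card =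
        (Φ.filter fun s => χ (Additive.ofMul s) =
            Complex.I ^ e * (χ (Additive.ofMul u) ^ x'.val * χ (Additive.ofMul v) ^ y.val)).card +
          (Φ.filter fun s => χ (Additive.ofMul s) =
            Complex.I ^ e * (χ (Additive.ofMul u) ^ x.val * χ (Additive.ofMul v) ^ y'.val)).card := by
      intro g e hg a a' b b'
      have hg' : χ (Additive.ofMul g) =
          Complex.I ^ e * (χ (Additive.ofMul u) ^ (0 : ZMod p).val * χ (Additive.ofMul v) ^ (0 : ZMod q).val) := by
        rw [hg, ZMod.val_zero, ZMod.val_zero, pow_zero, pow_zero, mul_one, mul_one]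
      have hxx : (u ^ (a' - a).val) ^ p ∈ H := by
        rw [← hker, char_pow_fp, char_pow_fp, ← pow_mul, mul_comm, pow_mul, hu.pow_eq_one, one_pow]
      have hyy : (v ^ (b' - b).val) ^ q ∈ H := by
        rw [← hker, char_pow_fp, char_pow_fp, ← pow_mul, mul_comm, pow_mul, hv.pow_eq_one, one_pow]
      have key := hcoset (g * (u ^ a.val * v ^ b.val)) (u ^ (a' - a).val) (v ^ (b' - b).val) hxx hyy
      have v1 : χ (Additive.ofMul (g * (u ^ a.val * v ^ b.val) * u ^ (a' - a).val)) =
          χ (Additive.ofMul (g * (u ^ a'.val * v ^ b.val))) := by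
        rw [char_mul_fp, char_mul_fp, char_mul_fp, char_pow_fp, char_pow_fp, char_pow_fp, char_mul_fp, char_mul_fp,
          char_pow_fp, char_pow_fp, show a' = a + (a' - a) by rw [add_sub_cancel], pow_val_add_fp hu, add_sub_cancel]
        ring
      have v2 : χ (Additive.ofMul (g * (u ^ a.val * v ^ b.val) * v ^ (b' - b).val)) =
          χ (Additive.ofMul (g * (u ^ a.val * v ^ b'.val))) := by
        rw [char_mul_fp, char_mul_fp, char_mul_fp, char_pow_fp, char_pow_fp, char_pow_fp, char_mul_fp, char_mul_fp,
          char_pow_fp, char_pow_fp, show b' = b + (b' - b) by rw [add_sub_cancel], pow_val_add_fp hv, add_sub_cancel]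
        ring
      have v3 : χ (Additive.ofMul (g * (u ^ a.val * v ^ b.val) * u ^ (a' - a).val * v ^ (b' - b).val)) =
          χ (Additive.ofMul (g * (u ^ a'.val * v ^ b'.val))) := by
        rw [char_mul_fp, v1, char_mul_fp, char_mul_fp, char_pow_fp, char_pow_fp, char_pow_fp, char_mul_fp, char_mul_fp,
          char_pow_fp, char_pow_fp, show b' = b + (b' - b) by rw [add_sub_cancel], pow_val_add_fp hv, add_sub_cancel]
        ring
      rw [hNc _ _ v1, hNc _ _ v2, hNc _ _ v3, hbase g e 0 0 hg', hbase g e 0 0 hg', hbase g e 0 0 hg',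
        hbase g e 0 0 hg'] at key
      simp only [zero_add] at key
      omega
    exact ⟨hsepOf 1 0 (by rw [pow_zero, char_one_fp]), hsepOf w₄ 1 (by rw [pow_one, hw₄])⟩

omit [DecidableEq G] in
/-- **All characters of an index-`4pq` kernel at once**: for `H ∌ ρ` with `G/H` cyclic of order `4pq` (`p ≠ q` odd primes), the
`φ(4pq) = 2(p−1)(q−1)` characters with kernel `H` vanish on `S` iff the coset counts of `S` are additively separable along the odd part of
`G/H` from every base point (so `H` contributes `2(p−1)(q−1)` to Kubota's defect iff so). [cite: Kubota1965, §4 Lemma 2]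
[cite: Hazama2003CyclicCM, Thm. 4.8] [cite: White1993SporadicCycles, §4, proof of Lemma 3 (p. 131)] -/
theorem forall_sum_char_eq_zero_iff_separable_of_index_four_mul_odd_primes (hpq : p ≠ q) (hp2 : p ≠ 2) (hq2 : q ≠ 2)
    (h : IsCMTypeWith ρ (Φ : Set G)) {H : Subgroup G} (hρH : ρ ∉ H) (hcyc : IsCyclic (G ⧸ H))
    (hidx : H.index = 4 * (p * q)) :
    (∀ χ : AddChar (Additive G) ℂ, (∀ g : G, χ (Additive.ofMul g) = 1 ↔ g ∈ H) →
        ∑ s ∈ Φ, χ (Additive.ofMul s) = 0) ↔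
      ∀ g x y : G, x ^ p ∈ H → y ^ q ∈ H →
        (Φ.filter fun s => g⁻¹ * s ∈ H).card + (Φ.filter fun s => (g * x * y)⁻¹ * s ∈ H).card =
          (Φ.filter fun s => (g * x)⁻¹ * s ∈ H).card + (Φ.filter fun s => (g * y)⁻¹ * s ∈ H).card := by
  have hρ2 := rho_mul_rho_fp h
  rw [forall_sum_char_eq_zero_iff_exists hρH hρ2 hcyc Φ]
  constructor
  · rintro ⟨ψ, hψ, h0⟩
    exact (sum_char_eq_zero_iff_separable_of_index_four_mul_odd_primes hpq hp2 hq2 h ψ hρH hψ hidx hcyc).1 h0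
  · intro hsep
    obtain ⟨χ, -, hker⟩ := exists_oddChar_ker hρH hρ2 hcyc
    exact ⟨χ, hker, (sum_char_eq_zero_iff_separable_of_index_four_mul_odd_primes hpq hp2 hq2 h χ hρH hker hidx hcyc).2 hsep⟩

end IndexFourTwoOddPrimes

end AbelianKernels

end CyclicCMType

end Literature.NumberTheory.ComplexMultiplication

end
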